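import Summits.HodgeConjecture.HodgeConjecture.Theorems.MarkmanPartnerTransportPicardThreeK3SquaresRMTypeOpenSubtype
import HarnessLib

/-!
# Route MarkmanPartnerTransport · crux `PicardThreeK3Squares` (stmt-HodgeConjecture-19652) —
# (T⁗) BY NAME: sub-type descent from an open set, with the eigenvalue and the certificate derived

Cell hodge-nonav, crux #4 (HC⁴(S ⊗ S), ρ(S) ≥ 3; open core: real multiplication), programme «RATIONAL ORBIT
DENSITY» continued (prover seat hodge-nonav-19652-p1 gen 20; `--supports stmt-HodgeConjecture-19652`,
helper). Sequel to `…RMTypeOpenSubtype` ((T⁗) `hodgeConjectureFor_square_of_openAll_of_transc`: HC⁴(S ⊗ S)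
for a marked projective K3 surface whose generator is conjugate ON `T(S)` ONLY to a self-adjoint model `θ`
that is cycle-induced at every period of an open subset of its Hodge locus — the Noether–Lefschetz-special
surfaces of the locus included). CONDITIONAL on `Buskin2019_hodgeIsometry_algebraic` and the displayed
strong open input only; credits nothing; nothing here says HC is proved.

* **`hodgeConjectureFor_square_of_openAll_of_transc_of_separable`** — (T⁗) with EXACTLY the RM binders of
  (T‴) `hodgeConjectureFor_square_of_exists_on_open_at_of_isK3Surface` (`t` rational, type-preserving,
  killing `N¹`, annihilated on `T(S)` by a separable `P ∈ ℚ[X]` with `P(0) ≠ 0`, generating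
  `End_Hdg T(S)`), the conjugation asked on `T(S)` only, plus ONE model hypothesis `θ_ℂ · P(θ_ℂ) = 0` on
  `Λ_ℂ`: for a sub-type it can no longer be transported from `S` (whose conjugation holds on `T(S)`
  only); for the van Geemen–Schütt models it is a tree identity (`thetaC_mul_cubic_eq_zero_of_zeta9Model`,
  …). The `(2,0)`-eigenvalue `e'` of `t` is a root of `P` (the period class is cup-transcendental), real
  (`star_eigenvalue_eq`) and non-zero (`P(0) ≠ 0`); it EQUALS the eigenvalue `e₀` of the open set because
  the Hodge locus of `θ` lives in one eigenvalue (`eigenvalue_eq_of_periodPts`, positive kernel vector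
  from the generic witness, `exists_posKernel_of_openAll`); the certificate is
  `exists_eigenprojector_certificate`.

No definition, no sorry, no new named fact. References: van Geemen–Schütt, Forum Math. Sigma 13 (2025) e2,
§2.1, §3.4, §4.8, §6.6; Buskin, J. reine angew. Math. 755 (2019), Thm. 1.1; Huybrechts, *Lectures on K3
Surfaces*, Ch. 6 Prop. 1.5, Ch. 14 §0.3 (vi); Lang, *Algebra*, Ch. XIV §2–§3.
-/

set_option linter.dupNamespace false

noncomputable section

namespace Summit.HodgeConjecture.HodgeConjecture.Theorems.MarkmanPartnerTransport.RMTypeOrbit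

open CategoryTheory MonoidalCategory Polynomial
open Literature.AlgebraicGeometry Literature.AlgebraicGeometry.Motives Literature.AlgebraicGeometry.HodgeTheory
open Literature.AlgebraicGeometry.Surfaces Literature.LinearAlgebra.QuadraticForm
open Literature.AlgebraicTopology.SingularHomology
open Summit.HodgeConjecture.HodgeConjecture.Theorems.NikulinTwinTransport
open Summit.HodgeConjecture.HodgeConjecture.Theorems.MarkmanPartnerTransport.IsogenyInvariance
open Summit.HodgeConjecture.HodgeConjecture.Theorems.MarkmanPartnerTransport.RMTypeDescent

/-- `MarkedK3[S, η, p, x]`: VERBATIM the `let MarkedK3 := …` binder of the route declaration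
`PicardThreeK3Squares` (as in `…RMTypeDescent`). Local notation only. -/
local notation3 (prettyPrint := false) "MarkedK3[" S ", " η ", " p ", " x "]" =>
  (p ≠ 0 ∧ (IsIntegralClass p ∧
    (∀ q : complexBetti S (2 * 2), IsIntegralClass q → ∃ n : ℤ, q = n • p) ∧
    (∀ c : complexBetti S (2 * 1), IsIntegralClass c ↔ ∃ v : K3Index → ℤ, η c = fun i => (v i : ℂ)) ∧
    (∀ a b : complexBetti S (2 * 1),
      cupProduct (rfl : 2 * 1 + 2 * 1 = 2 * 2) a b = k3Form (η a) (η b) • p) ∧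
    IsOfHodgeType 2 S (2 * 1) 2 0 (LinearEquiv.symm η x) ∧
    (∀ τ : complexBetti S (2 * 1), IsOfHodgeType 2 S (2 * 1) 2 0 τ →
      ∃ t : ℂ, τ = t • LinearEquiv.symm η x)) ∧
    (k3Form x x = 0 ∧ 0 < (k3Form (star x) x).re ∧
      ∃ u : K3Index → ℤ, k3Form (fun i => (u i : ℂ)) x = 0 ∧ 0 < ∑ i, ∑ j, u i * k3Gram i j * u j))

variable {S : SchemeOver ℂ}

/-- `CycleAll[θ, e, U]`: the STRONG ∃-form open-set input — at EVERY period point of `D_{θ,e}` in `U`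
(`θ`-generic OR NOT) there is a marked projective K3 surface carrying an algebraic class inducing
`η'⁻¹ θ_ℂ η'`. (`CycleEx[θ, e, U]` of `…RMTypeOpenExists` is the same clause restricted to `θ`-generic
periods.) Local notation only. -/
local notation3 (prettyPrint := false) "CycleAll[" θ ", " e ", " U "]" =>
  (∀ y : K3Index → ℂ, y ∈ U → thetaC θ y = (e : ℂ) • y → k3Form y y = 0 → 0 < (k3Form (star y) y).re →
    ∃ (S' : SchemeOver ℂ) (hS' : IsK3Surface S') (η' : complexBetti S' (2 * 1) ≃ₗ[ℂ] (K3Index → ℂ))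
      (p' : complexBetti S' (2 * 2)), MarkedK3[S', η', p', y] ∧
      ∃ γ' ∈ algebraicClasses (S' ⊗ S') 2, ∀ z : complexBetti S' (2 * 1),
        (η'.symm.toLinearMap ∘ₗ (thetaC θ ∘ₗ η'.toLinearMap)) z =
          complexGysin complexOrientationFamily
            (IsSmoothProjective.tensor_holds hS'.isSmoothProjective hS'.isSmoothProjective)
            hS'.isSmoothProjective (SemiCartesianMonoidalCategory.fst S' S')
            (rfl : 2 * 1 + 2 * 2 + 2 * 2 = 2 * 1 + 2 * (2 + 2))
            (cupProduct (rfl : 2 * 1 + 2 * 2 = 2 * 1 + 2 * 2)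
              (complexBetti.map (SemiCartesianMonoidalCategory.snd S' S') (2 * 1) z) γ'))

/-- `OpenAll[θ, e]`: there is an open `U ⊂ Λ_ℂ` containing a `θ`-GENERIC period point of `D_{θ,e}` on
which `CycleAll[θ, e, U]` holds. Local notation only. -/
local notation3 (prettyPrint := false) "OpenAll[" θ ", " e "]" =>
  (∃ U : Set (K3Index → ℂ), IsOpen U ∧
    (∃ y₁ ∈ U, thetaC θ y₁ = (e : ℂ) • y₁ ∧ k3Form y₁ y₁ = 0 ∧ 0 < (k3Form (star y₁) y₁).re ∧
      ∀ v : K3Index → ℚ, k3Form (fun i => (v i : ℂ)) y₁ = 0 → Matrix.mulVec θ v = 0) ∧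
    CycleAll[θ, e, U])

/-- **(T⁗) BY NAME from the RM data** — as `hodgeConjectureFor_square_of_openAll_of_transc`, with the
eigenvalue and the eigenprojector certificate DERIVED: the generator `t` is annihilated on `T(S)` by a
separable `P ∈ ℚ[X]` with `P(0) ≠ 0` (`IsAnnihilatedOnTranscendentalBy S t P`), and the MODEL satisfies
`θ_ℂ · P(θ_ℂ) = 0` on `Λ_ℂ` (a hypothesis on `θ` alone — for a sub-type it can no longer be transported
from `S`, whose conjugation holds on `T(S)` only; for the van Geemen–Schütt models it is the tree's
`thetaC_mul_cubic_eq_zero_of_zeta9Model` etc.). The `(2,0)`-eigenvalue `e'` of `t` is a root of `P`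
(the period class is cup-transcendental), real (`star_eigenvalue_eq`) and non-zero (`P(0) ≠ 0`); it
EQUALS the eigenvalue `e₀` of the open set because the Hodge locus of `θ` lives in one eigenvalue
(`eigenvalue_eq_of_periodPts`, positive kernel vector from the generic witness); the certificate is
`exists_eigenprojector_certificate`. CONDITIONAL on `Buskin2019_hodgeIsometry_algebraic` and the displayed
strong open input only; credits nothing; HC is NOT proved here.
[cite: GeemenSchutt2023, §2.1, §3.4 and §4.8] [cite: Buskin2019, Thm. 1.1]
[cite: Huybrechts2016K3, Ch. 6 Prop. 1.5 and Ch. 14 §0.3 (vi)] [cite: Lang2002, Ch. XIV §2–§3] -/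
theorem hodgeConjectureFor_square_of_openAll_of_transc_of_separable
    (hB : Buskin2019_hodgeIsometry_algebraic)
    {θ : Matrix K3Index K3Index ℚ}
    (hθsa : ∀ a b : K3Index → ℂ, k3Form (thetaC θ a) b = k3Form a (thetaC θ b))
    {e₀ : ℝ} (he₀ : e₀ ≠ 0)
    {P : ℚ[X]} (hPsep : P.Separable) (hP0 : P.eval 0 ≠ 0)
    (hθP : aeval (thetaC θ) (X * P.map (algebraMap ℚ ℂ)) = 0)
    (hOpen : OpenAll[θ, e₀])
    (hS : IsK3Surface S)
    (η : complexBetti S (2 * 1) ≃ₗ[ℂ] (K3Index → ℂ)) (p : complexBetti S (2 * 2)) (x : K3Index → ℂ)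
    (hM : MarkedK3[S, η, p, x])
    (t : complexBetti S (2 * 1) →ₗ[ℂ] complexBetti S (2 * 1))
    (ht_rat : ∀ y, IsRationalClass y → IsRationalClass (t y))
    (ht_typ : ∀ (i j : ℕ) (y : complexBetti S (2 * 1)),
      IsOfHodgeType 2 S (2 * 1) i j y → IsOfHodgeType 2 S (2 * 1) i j (t y))
    (ht_N : ∀ d ∈ algebraicClasses S 1, t d = 0)
    (hP : IsAnnihilatedOnTranscendentalBy S t P) (hgen : TranscendentalEndomorphismsGeneratedBy S t)
    (σ : Module.End ℂ (K3Index → ℂ)) (hσ : ∀ a b, k3Form (σ a) (σ b) = k3Form a b)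
    (hσrat : ∀ v : K3Index → ℤ, ∃ w : K3Index → ℚ, σ (fun i => (v i : ℂ)) = fun i => (w i : ℂ))
    (hconj : ∀ c : complexBetti S (2 * 1),
      (∀ d ∈ algebraicClasses S 1, cupProduct (rfl : 2 * 1 + 2 * 1 = 2 * 2) c d = 0) →
        σ (η (t c)) = thetaC θ (σ (η c))) :
    HodgeConjectureFor 4 (S ⊗ S) := by
  classical
  have hHT : Huybrechts_K3_hodgeTypes_H2 := Huybrechts_K3_hodgeTypes_H2_holds
  have h4 : 2 * 1 + 2 * 1 = 2 * 2 := rfl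
  have hM' := hM
  obtain ⟨hp0, ⟨hpint, hpgen, hηint, hηcup, h20, hline⟩, hPer⟩ := hM'
  have hxpos : 0 < (k3Form (star x) x).re := hPer.2.1
  have hx0 : η.symm x ≠ 0 := fun h0 =>
    ne_zero_of_star_self_re_pos hxpos (by simpa using congrArg η h0)
  have htransc : ∀ d ∈ algebraicClasses S 1, cupProduct h4 (η.symm x) d = 0 := by
    intro d hd
    obtain ⟨-, -, h3⟩ := hHT S hS (η.symm x) h20 hx0
    have h11 : IsOfHodgeType 2 S (2 * 1) 1 1 d :=
      isOfHodgeType_of_mem_algebraicClasses_of_isSmoothProjective hS.isSmoothProjective 1 hd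
    have hds := ((h3 d).1 h11).1
    rw [cupProduct_gradedComm_holds ℂ _ (rfl : 2 * 1 + 2 * 1 = 2 * 2) rfl]
    norm_num
    exact hds
  -- the `(2,0)`-eigenvalue `e'` of `t`: a root of `P`, real, non-zero
  obtain ⟨e', he'⟩ := hline (t (η.symm x)) (ht_typ 2 0 _ h20)
  have heig' : thetaC θ (σ x) = e' • σ x := by
    have h1 := hconj (η.symm x) htransc
    rw [he', map_smul, LinearEquiv.apply_symm_apply, map_smul] at h1
    exact h1.symm
  have hPσ := periodPt_ratIsometry σ hσ hσrat hPer
  have hstar : star e' = e' := star_eigenvalue_eq hθsa heig' hPσ.2.1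
  have hee : ((e'.re : ℝ) : ℂ) = e' := Complex.conj_eq_iff_re.1 hstar
  set PC : ℂ[X] := P.map (algebraMap ℚ ℂ) with hPC
  have hroot : PC.IsRoot e' := by
    have h1 := hP (η.symm x) htransc
    rw [← hPC, aeval_apply_of_eigen he', smul_eq_zero] at h1
    exact h1.resolve_right hx0
  have he'0 : e'.re ≠ 0 := by
    intro hz
    have h0 : e' = 0 := by rw [← hee, hz, Complex.ofReal_zero]
    have h1 : PC.eval 0 = 0 := by
      have h2 : PC.eval e' = 0 := hroot
      rwa [h0] at h2
    rw [hPC, Polynomial.eval_map, Polynomial.eval₂_at_zero, map_eq_zero_iff _ (algebraMap ℚ ℂ).injective,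
      Polynomial.coeff_zero_eq_eval_zero] at h1
    exact hP0 h1
  -- the Hodge locus of `θ` lives in one eigenvalue: `e'.re = e₀`
  have hw := exists_posKernel_of_openAll hOpen
  have hOpen' := hOpen
  obtain ⟨U, -, ⟨y₁, -, hy₁, h₁₁, h₁p, -⟩, -⟩ := hOpen'
  have heq : e'.re = e₀ :=
    eigenvalue_eq_of_periodPts hθsa hw he'0 he₀ (by rw [hee]; exact heig') hPσ.1 hPσ.2.1 hy₁ h₁₁ h₁p
  have hee₀ : (e₀ : ℂ) = e' := by rw [← heq]; exact hee
  -- certificate at `e₀`, and (T⁗)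
  obtain ⟨π, hπe, hπW⟩ := exists_eigenprojector_certificate (thetaC θ) (hPsep.map) hθP hroot
  rw [← hee₀] at hπe hπW he'
  exact hodgeConjectureFor_square_of_openAll_of_transc hB hθsa he₀ hπe hπW hOpen hS η p x hM t ht_rat ht_N
    he' hgen σ hσ hσrat hconj

end Summit.HodgeConjecture.HodgeConjecture.Theorems.MarkmanPartnerTransport.RMTypeOrbit

end
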